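import Literature.NumberTheory.Transcendental.NashCubes
import Literature.NumberTheory.Transcendental.KZCalculusProofs
import Mathlib.Algebra.FreeAbelianGroup.Finsupp
import Mathlib.Analysis.Calculus.DifferentialForm.Basic
import Mathlib.Topology.Instances.Matrix
import HarnessLib

/-!
# Semialgebraic cubical chains, their boundary, and the KZ representation of a form along a chain

Definition request `defn-SemialgebraicCubicalChain` (route `KontsevichZagierPeriods/CyclesAsDomains`,
items `ZeroBulkStokes` stmt-6589 and `CertificateTransfer`; same vocabulary as `defn-NashChainRep` of
route `KontsevichZagierPeriods/CobordismMove`). Built on `NashCubes.lean` (the cells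
`NashCubeMap d N`: `ℚ`-semialgebraic `C¹` singular cubes `[0,1]ᵈ → ℝᴺ`, their faces
`NashCubeMap.face c j ε = c ∘ (x ↦ Fin.insertNth j ε x)`) and on the Kontsevich–Zagier calculus of
`KZCalculus.lean` (`KZ.IntegralRep`, `KZ.FormalRep`, `KZ.of`, `KZ.eval`, `KZ.relations`).

* `SemialgebraicCubicalChain d N` — the free abelian group on the cells: finite `ℤ`-combinations
  `Σ nⱼ cⱼ` of `ℚ`-semialgebraic `C¹` singular `d`-cubes in `ℝᴺ` (Spivak's singular `d`-chains with
  semialgebraic `C¹` cells). Cells are compared as MAPS (`NashCubeMap.ext`), so coinciding faces cancel.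
* `SemialgebraicCubicalChain.boundary` — the boundary operator
  `∂ c = Σ_{j : Fin (d+1)} (−1)ʲ (c.face j 1 − c.face j 0)` (Spivak's
  `∂ c = Σ_{i=1}^{n} Σ_{α=0,1} (−1)^{i+α} c_{(i,α)}`, re-indexed from `0`), extended additively;
  `boundary_boundary : ∂ (∂ Γ) = 0`.
* `IsSemialgebraicFormOn S ω` — a differential `d`-form `ω` on `ℝᴺ`, in Mathlib's representation
  `ω : (Fin N → ℝ) → (Fin N → ℝ) [⋀^Fin d]→L[ℝ] ℝ` (as in `extDeriv`), has `ℚ`-semialgebraic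
  coefficients on `S ⊆ ℝᴺ`: every coordinate coefficient `x ↦ ω x (e_{v 0}, …, e_{v (d-1)})` is a
  `ℚ`-semialgebraic function on `S`.
* `basicForm I` — the coordinate forms `dx_I` (`I : Fin d → Fin N`) as continuous alternating maps
  (the `I`-minor), so that concrete forms are written `fun x => Σ_{I ∈ s} a_I x • basicForm (e I)`;
  `isSemialgebraicFormOn_sum_smul_basicForm`, `pullbackDensity_sum_smul_basicForm` (Jacobian minors),
  `KZ.cubeRepDefined_sum_smul_basicForm`.
* `pullbackDensity c ω : (Fin d → ℝ) → ℝ` — the coefficient `f` of the pulled-back top form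
  `c^*ω = f dt₁ ∧ ⋯ ∧ dt_d` on the parameter cube: `f t = ω (c t) (∂₀c (t), …, ∂_{d-1} c (t))`;
  `pullbackDensity_eq_sum` expands it in coordinates and
  `IsSemialgebraicFormOn.isSemialgebraicFunOn_pullbackDensity` proves it `ℚ`-semialgebraic on the
  closed cube when `c` maps the closed cube into `S`.
* `KZ.cubeRep c ω : KZ.IntegralRep d` — the integral representation `[closed unit d-cube, f]` with
  `f = pullbackDensity c ω`, DEFINED WHEN `KZ.CubeRepDefined c ω` (the density is `ℚ`-semialgebraic and
  absolutely integrable on the closed cube); otherwise the junk value `[closed unit cube, 0]`.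
* `KZ.chainRep Γ ω : KZ.FormalRep` — `Σⱼ nⱼ [closed unit d-cube, pullbackDensity cⱼ ω]` for
  `Γ = Σⱼ nⱼ cⱼ`, the additive extension of `c ↦ KZ.of (KZ.cubeRep c ω)` (Spivak:
  `∫_{Σ aᵢcᵢ} ω = Σ aᵢ ∫_{[0,1]ᵏ} cᵢ^*ω`; Kontsevich–Zagier's rule (3) "Stokes's formula" acts on such
  elements); `KZ.chainRep_boundary_of` displays `chainRep (∂ c) ω` as the signed face sum
  `Σⱼ (−1)ʲ ([face j 1] − [face j 0])` of item `ZeroBulkStokes`, and `KZ.pullbackDensity_face`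
  identifies the face densities with the coefficients `Aⱼ` of `c^*ω` restricted to the faces.

## References

* M. Spivak, *Calculus on Manifolds* (1965), Ch. 4, "Integration on chains": singular `n`-cubes and
  `n`-chains, the `(i,α)`-faces and `∂`, Thm. 4-12 (`∂² = 0`), the integral of a form over a chain
  `∫_c ω = ∫_{[0,1]ᵏ} c^*ω`, Thm. 4-13 (Stokes on chains). [`Spivak1965`]
* M. Kontsevich, D. Zagier, *Periods* (2001), §1.2, rule (3). [`KontsevichZagier2001`]
* A. Huber, S. Müller-Stach, *Periods and Nori Motives* (2017), Def. 12.1.1 (naive periods: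
  `∫_G ω`, `G` a `ℚ̃`-semialgebraic domain, `ω` a rational form regular along `G`), Ch. 12–13.
  [`HuberMullerStach2017`]
* J. Bochnak, M. Coste, M.-F. Roy, *Real Algebraic Geometry* (1998), §2.2 (Prop. 2.2.6). [`BochnakCosteRoy1998`]

## Design notes

* Cubes rather than simplices: the Newton–Leibniz move of the tree's calculus (`KZ.newtonLeibnizRel`)
  integrates along one coordinate of a band, so Stokes on a cell is a sum over the `2d` coordinate
  faces (item `ZeroBulkStokes`). The simplicial semialgebraic chains computing singular homology
  (Huber 2023, Prop. 7.4) live in `Literature/ModelTheory/ExponentialFields/SemialgebraicChains.lean`.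
* Injectivity of cells and Nash regularity on the open cube (mentioned as alternatives in the request)
  are not fields of `NashCubeMap` and are not needed to form the representations; consumers add them
  as hypotheses (`Set.InjOn c (openUnitCube d)`) where a statement requires them.
* Forms are Mathlib's unbundled `E → E [⋀^Fin d]→L[ℝ] ℝ` so that closedness can be written with
  Mathlib's `extDeriv`/`extDerivWithin`; semialgebraicity of coefficients is the predicate
  `IsSemialgebraicFormOn`, in the style of `IsSemialgebraicFunOn`/`IsSemialgebraicMapOn`. Complex-valued
  algebraic forms enter through their real and imaginary parts, as everywhere in the KZ files.
* `KZ.chainRep` is total and additive in the chain (`KZ.chainRepHom`); the side condition of the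
  request ("defined when the pulled-back coefficient is integrable") is the predicate
  `KZ.CubeRepDefined` / `KZ.ChainRepDefined`, under which `KZ.cubeRep_integrand`, `KZ.value_cubeRep`
  compute the representation; it holds for forms with semialgebraic coefficients continuous along the
  cell (`KZ.cubeRepDefined_of_continuousOn`).
* The domain of every cell representation is the CLOSED unit cube `closedUnitCube d = Set.Icc 0 1`
  (`closedUnitCube_eq_setOf` rewrites it to the literal `{x | ∀ i, x i ∈ Set.Icc 0 1}` of item
  `ZeroBulkStokes`).
-/

noncomputable section

open Set MeasureTheory Function
open Literature.ModelTheory.ExponentialFields (IsSemialgebraic)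

namespace Literature.NumberTheory.Transcendental

variable {d N : ℕ}

/-! ## Two tuple lemmas -/

/-- The closed unit cube written coordinatewise, as in the signature of item `ZeroBulkStokes`.
[folklore] -/
theorem closedUnitCube_eq_setOf (d : ℕ) :
    closedUnitCube d = {x : Fin d → ℝ | ∀ i, x i ∈ Icc (0 : ℝ) 1} :=
  Set.ext fun _ => mem_closedUnitCube_iff

/-- A vector of `ℝᴺ` is the combination of the standard basis vectors with its coordinates as
coefficients. [folklore] -/
theorem eq_sum_smul_single (x : Fin N → ℝ) :
    x = ∑ j : Fin N, x j • (Pi.single j (1 : ℝ) : Fin N → ℝ) := by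
  ext l
  simp [Finset.sum_apply, Pi.single_apply]

/-- Commuting two insertions into a tuple: inserting `b` at `j` and then `a` at `i` is inserting `a`
at `j.predAbove i` and then `b` at `i.succAbove j` (the cubical face relation
`(c_{(i,α)})_{(j,β)} = (c_{(j+1,β)})_{(i,α)}`, `i ≤ j`, of Spivak, in `succAbove`/`predAbove` form).
[cite: Spivak1965, Ch. 4, proof of Thm. 4-12] -/
theorem insertNth_insertNth_comm {α : Type*} {n : ℕ} (i : Fin (n + 2)) (j : Fin (n + 1)) (a b : α)
    (x : Fin n → α) :
    (Fin.insertNth i a (Fin.insertNth j b x) : Fin (n + 2) → α) =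
      Fin.insertNth (i.succAbove j) b (Fin.insertNth (j.predAbove i) a x) := by
  funext l
  refine Fin.succAboveCases i ?_ (fun m => ?_) l
  · -- `l = i = (i.succAbove j).succAbove (j.predAbove i)`
    have key : (Fin.insertNth (i.succAbove j) b (Fin.insertNth (j.predAbove i) a x) :
        Fin (n + 2) → α) ((i.succAbove j).succAbove (j.predAbove i)) = a := by
      rw [Fin.insertNth_apply_succAbove, Fin.insertNth_apply_same]
    rw [Fin.succAbove_succAbove_predAbove] at key
    rw [Fin.insertNth_apply_same, key]
  · rw [Fin.insertNth_apply_succAbove]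
    refine Fin.succAboveCases j ?_ (fun p => ?_) m
    · rw [Fin.insertNth_apply_same, Fin.insertNth_apply_same]
    · rw [Fin.insertNth_apply_succAbove, ← Fin.succAbove_succAbove_succAbove_predAbove i j p,
        Fin.insertNth_apply_succAbove, Fin.insertNth_apply_succAbove]

/-! ## Finite sums and products of semialgebraic functions -/

section SumProd

variable {k : Type*} [CommRing k] [Algebra k ℝ] {m : ℕ} {ι : Type*}

/-- A finite sum of real `k`-semialgebraic functions is semialgebraic (from the two-term case,
Bochnak–Coste–Roy Prop. 2.2.6, `IsSemialgebraicFunOn.add_holds`). [cite: BochnakCosteRoy1998, Prop. 2.2.6] -/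
theorem isSemialgebraicFunOn_finsetSum (s : Finset ι) {S : Set (Fin m → ℝ)} (hS : IsSemialgebraic k S)
    {f : ι → (Fin m → ℝ) → ℝ} (hf : ∀ i ∈ s, IsSemialgebraicFunOn k S (f i)) :
    IsSemialgebraicFunOn k S fun x => ∑ i ∈ s, f i x := by
  classical
  induction s using Finset.induction_on with
  | empty => simpa using isSemialgebraicFunOn_natCast hS 0
  | insert a s ha ih =>
    have h := IsSemialgebraicFunOn.add_holds (hf a (Finset.mem_insert_self a s))
      (ih fun i hi => hf i (Finset.mem_insert_of_mem hi))
    refine h.congr fun x _ => ?_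
    simp [Finset.sum_insert ha]

/-- A finite product of real `k`-semialgebraic functions is semialgebraic (from the two-term case,
Bochnak–Coste–Roy Prop. 2.2.6, `IsSemialgebraicFunOn.mul_holds`). [cite: BochnakCosteRoy1998, Prop. 2.2.6] -/
theorem isSemialgebraicFunOn_finsetProd (s : Finset ι) {S : Set (Fin m → ℝ)} (hS : IsSemialgebraic k S)
    {f : ι → (Fin m → ℝ) → ℝ} (hf : ∀ i ∈ s, IsSemialgebraicFunOn k S (f i)) :
    IsSemialgebraicFunOn k S fun x => ∏ i ∈ s, f i x := by
  classical
  induction s using Finset.induction_on with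
  | empty => simpa using isSemialgebraicFunOn_natCast hS 1
  | insert a s ha ih =>
    have h := IsSemialgebraicFunOn.mul_holds (hf a (Finset.mem_insert_self a s))
      (ih fun i hi => hf i (Finset.mem_insert_of_mem hi))
    refine h.congr fun x _ => ?_
    simp [Finset.prod_insert ha]

/-- Constant functions with integer value are `k`-semialgebraic on every `k`-semialgebraic set (the
constant polynomial `z ∈ k[X]`). [cite: BochnakCosteRoy1998, §2.2] -/
theorem isSemialgebraicFunOn_intCast {S : Set (Fin m → ℝ)} (hS : IsSemialgebraic k S) (z : ℤ) :
    IsSemialgebraicFunOn k S fun _ => (z : ℝ) :=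
  (isSemialgebraicFunOn_aeval hS (z : MvPolynomial (Fin m) k)).congr fun x _ => by simp

end SumProd

/-- A face of a cell mapping the closed cube into `S` maps the closed cube into `S`. [folklore] -/
theorem NashCubeMap.mapsTo_face {S : Set (Fin N → ℝ)} {c : NashCubeMap (d + 1) N}
    (hc : MapsTo c (closedUnitCube (d + 1)) S) (j : Fin (d + 1)) (ε : Fin 2) :
    MapsTo (c.face j ε) (closedUnitCube d) S :=
  hc.comp (NashCubeMap.mapsTo_faceMap j ε)

/-! ## Semialgebraic cubical chains and their boundary -/

/-- A **`ℚ`-semialgebraic cubical `d`-chain in `ℝᴺ`**: a finite `ℤ`-linear combination `Σ nⱼ cⱼ` of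
`ℚ`-semialgebraic `C¹` singular `d`-cubes `cⱼ : [0,1]ᵈ → ℝᴺ` (`NashCubeMap d N`), i.e. an element of the
free abelian group on the cells (Spivak's singular `d`-chains, with semialgebraic `C¹` cells as in the
Kontsevich–Zagier calculus). Cells are equal iff their underlying maps are (`NashCubeMap.ext`).
[cite: Spivak1965, Ch. 4 (singular n-cubes and n-chains)] -/
abbrev SemialgebraicCubicalChain (d N : ℕ) : Type := FreeAbelianGroup (NashCubeMap d N)

namespace SemialgebraicCubicalChain

/-- A chain is the sum over its support of its cells with their multiplicities:
`Γ = Σ_{c ∈ supp Γ} (coeff_c Γ) · c` (Mathlib's `FreeAbelianGroup.support`/`coeff`). [folklore] -/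
theorem sum_coeff_smul_of (Γ : SemialgebraicCubicalChain d N) :
    ∑ c ∈ Γ.support, FreeAbelianGroup.coeff c Γ • FreeAbelianGroup.of c = Γ := by
  conv_rhs => rw [← Finsupp.toFreeAbelianGroup_toFinsupp Γ]
  rw [Finsupp.toFreeAbelianGroup, Finsupp.liftAddHom_apply, Finsupp.sum]
  rfl

/-- The **boundary** of a cubical chain: on a cell,
`∂ c = Σ_{j : Fin (d+1)} (−1)ʲ (c.face j 1 − c.face j 0)`, where `c.face j ε = c ∘ (x ↦ insertNth j ε x)`
is the face with `ε` inserted as `j`-th coordinate (Spivak's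
`∂ c = Σ_{i=1}^{n} Σ_{α=0,1} (−1)^{i+α} c_{(i,α)}` with `i = j + 1`), extended additively to chains.
[cite: Spivak1965, Ch. 4 (definition of ∂ before Thm. 4-12)] -/
def boundary : SemialgebraicCubicalChain (d + 1) N →+ SemialgebraicCubicalChain d N :=
  FreeAbelianGroup.lift fun c =>
    ∑ j : Fin (d + 1), (-1 : ℤ) ^ (j : ℕ) •
      (FreeAbelianGroup.of (c.face j 1) - FreeAbelianGroup.of (c.face j 0))

/-- The boundary of a single cell. [cite: Spivak1965, Ch. 4] -/
theorem boundary_of (c : NashCubeMap (d + 1) N) :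
    boundary (FreeAbelianGroup.of c) = ∑ j : Fin (d + 1), (-1 : ℤ) ^ (j : ℕ) •
      (FreeAbelianGroup.of (c.face j 1) - FreeAbelianGroup.of (c.face j 0)) :=
  FreeAbelianGroup.lift_apply_of _ _

/-- The boundary of a single cell as a double sum over faces `(j, ε)` with signs `(−1)^{j+ε+1}`.
[cite: Spivak1965, Ch. 4] -/
theorem boundary_of_eq_sum_sum (c : NashCubeMap (d + 1) N) :
    boundary (FreeAbelianGroup.of c) = ∑ j : Fin (d + 1), ∑ ε : Fin 2,
      (-1 : ℤ) ^ ((j : ℕ) + (ε : ℕ) + 1) • FreeAbelianGroup.of (c.face j ε) := by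
  rw [boundary_of]
  refine Finset.sum_congr rfl fun j _ => ?_
  simp only [Fin.sum_univ_two, Fin.val_zero, Fin.val_one, add_zero, pow_succ, mul_neg, mul_one,
    neg_neg, neg_smul, smul_sub]
  abel

/-- **The face relation** for iterated faces of a `(d+2)`-cube `c`:
`(c.face i a).face j b = (c.face (i.succAbove j) b).face (j.predAbove i) a`
(Spivak: `(c_{(i,α)})_{(j,β)} = (c_{(j+1,β)})_{(i,α)}` for `i ≤ j`, here in `succAbove`/`predAbove` form,
which covers both orders at once).
[cite: Spivak1965, Ch. 4, proof of Thm. 4-12] -/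
theorem face_face_comm (c : NashCubeMap (d + 2) N) (i : Fin (d + 2)) (j : Fin (d + 1)) (a b : Fin 2) :
    (c.face i a).face j b = (c.face (i.succAbove j) b).face (j.predAbove i) a := by
  apply NashCubeMap.ext
  funext x
  simp only [NashCubeMap.coe_face, Function.comp_apply, NashCubeMap.faceMap]
  rw [insertNth_insertNth_comm]

/-- **`∂² = 0`** on a cell: the faces `(c.face i a).face j b` and
`(c.face (i.succAbove j) b).face (j.predAbove i) a` coincide and carry opposite signs, so all terms of
`∂ (∂ c)` cancel in pairs (`Finset.sum_involution` on the fixed-point-free involution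
`(i, j) ↦ (i.succAbove j, j.predAbove i)`). [cite: Spivak1965, Thm. 4-12] -/
theorem boundary_boundary_of (c : NashCubeMap (d + 2) N) :
    boundary (boundary (FreeAbelianGroup.of c)) = 0 := by
  -- write `∂∂c` as a sum over `((i, j), (a, b))`: the `(j, b)`-face of the `(i, a)`-face
  have hexp : boundary (boundary (FreeAbelianGroup.of c)) =
      ∑ p : (Fin (d + 2) × Fin (d + 1)) × (Fin 2 × Fin 2),
        ((-1 : ℤ) ^ ((p.1.1 : ℕ) + (p.2.1 : ℕ) + 1) * (-1 : ℤ) ^ ((p.1.2 : ℕ) + (p.2.2 : ℕ) + 1)) •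
          FreeAbelianGroup.of ((c.face p.1.1 p.2.1).face p.1.2 p.2.2) := by
    rw [boundary_of_eq_sum_sum, map_sum]
    simp_rw [map_sum, map_zsmul, boundary_of_eq_sum_sum, Finset.smul_sum, smul_smul]
    rw [Fintype.sum_prod_type]
    simp_rw [Fintype.sum_prod_type]
    exact Finset.sum_congr rfl fun i _ => Finset.sum_comm
  rw [hexp]
  -- the terms cancel in pairs along the involution `(i, j) ↦ (i.succAbove j, j.predAbove i)`
  refine Finset.sum_ninvolution
    (fun p => ((p.1.1.succAbove p.1.2, p.1.2.predAbove p.1.1), (p.2.2, p.2.1))) ?_ ?_ ?_ ?_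
  · -- paired terms cancel
    rintro ⟨⟨i, j⟩, ⟨a, b⟩⟩
    dsimp only
    rw [← face_face_comm c i j a b, ← add_smul]
    convert zero_smul ℤ (FreeAbelianGroup.of ((c.face i a).face j b)) using 2
    -- sign computation: the parities of `i + j` and `i.succAbove j + j.predAbove i` differ
    rcases lt_or_ge (Fin.castSucc j) i with h | h
    · rw [Fin.succAbove_of_castSucc_lt _ _ h, Fin.predAbove_of_castSucc_lt _ _ h]
      have hi1 : 1 ≤ (i : ℕ) := by
        have := Fin.lt_def.mp h
        simp only [Fin.val_castSucc] at this
        omega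
      simp only [Fin.val_castSucc, Fin.val_pred]
      generalize (i : ℕ) = n at hi1 ⊢
      obtain ⟨i0, rfl⟩ : ∃ i0, n = i0 + 1 := ⟨n - 1, by omega⟩
      simp only [Nat.add_sub_cancel]
      ring
    · rw [Fin.succAbove_of_le_castSucc _ _ h, Fin.predAbove_of_le_castSucc _ _ h]
      simp only [Fin.val_succ, Fin.coe_castPred]
      ring
  · -- no fixed points: a fixed point would have `i.succAbove j = i`
    rintro ⟨⟨i, j⟩, ⟨a, b⟩⟩ _ heq
    simp only [Prod.mk.injEq] at heq
    exact absurd heq.1.1 (Fin.succAbove_ne i j)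
  · exact fun _ => Finset.mem_univ _
  · rintro ⟨⟨i, j⟩, ⟨a, b⟩⟩
    simp only [Fin.succAbove_succAbove_predAbove, Fin.predAbove_predAbove_succAbove]

/-- **`∂² = 0`** (Spivak, Thm. 4-12): the boundary of the boundary of any cubical chain vanishes.
[cite: Spivak1965, Thm. 4-12] -/
theorem boundary_boundary (Γ : SemialgebraicCubicalChain (d + 2) N) : boundary (boundary Γ) = 0 := by
  induction Γ using FreeAbelianGroup.induction_on with
  | zero => simp
  | of c => exact boundary_boundary_of c
  | neg c h => rw [map_neg, map_neg, h, neg_zero]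
  | add x y hx hy => rw [map_add, map_add, hx, hy, add_zero]

end SemialgebraicCubicalChain

/-! ## Differential forms with semialgebraic coefficients and the pull-back density -/

/-- A differential `d`-form `ω` on `ℝᴺ` (Mathlib: `ω x : (Fin N → ℝ) [⋀^Fin d]→L[ℝ] ℝ`) **has
`ℚ`-semialgebraic coefficients on `S ⊆ ℝᴺ`** if all its coordinate coefficients
`x ↦ ω x (e_{v 0}, …, e_{v (d-1)})`, `v : Fin d → Fin N` (`e_j = Pi.single j 1`), are `ℚ`-semialgebraic
functions on `S` (Bochnak–Coste–Roy Def. 2.2.5); e.g. a rational `d`-form `Σ_I f_I dx_I`,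
`f_I ∈ ℚ(x₁, …, x_N)`, on the complement `S` of its polar locus (Huber–Müller-Stach, Def. 12.1.1), or an
algebraic one. Only the values of `ω` on `S` matter. [cite: HuberMullerStach2017, Def. 12.1.1] -/
def IsSemialgebraicFormOn (S : Set (Fin N → ℝ)) (ω : (Fin N → ℝ) → (Fin N → ℝ) [⋀^Fin d]→L[ℝ] ℝ) :
    Prop :=
  ∀ v : Fin d → Fin N, IsSemialgebraicFunOn ℚ S fun x => ω x fun i => Pi.single (v i) 1

namespace IsSemialgebraicFormOn

variable {S T : Set (Fin N → ℝ)} {ω ω' : (Fin N → ℝ) → (Fin N → ℝ) [⋀^Fin d]→L[ℝ] ℝ}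

/-- Restriction to a semialgebraic subset. [cite: BochnakCosteRoy1998, §2.2] -/
theorem mono (hω : IsSemialgebraicFormOn S ω) (hTS : T ⊆ S) (hT : IsSemialgebraic ℚ T) :
    IsSemialgebraicFormOn T ω := fun v => (hω v).mono hTS hT

/-- Only the values on `S` matter. [cite: BochnakCosteRoy1998, Def. 2.2.5] -/
theorem congr (hω : IsSemialgebraicFormOn S ω) (h : EqOn ω ω' S) : IsSemialgebraicFormOn S ω' :=
  fun v => (hω v).congr fun x hx => by simp only [h hx]

/-- Sums of forms with semialgebraic coefficients. [cite: BochnakCosteRoy1998, Prop. 2.2.6] -/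
theorem add (hω : IsSemialgebraicFormOn S ω) (hω' : IsSemialgebraicFormOn S ω') :
    IsSemialgebraicFormOn S (ω + ω') := fun v =>
  (IsSemialgebraicFunOn.add_holds (hω v) (hω' v)).congr fun x _ => by simp

/-- Negatives. [cite: BochnakCosteRoy1998, Prop. 2.2.6] -/
theorem neg (hω : IsSemialgebraicFormOn S ω) : IsSemialgebraicFormOn S (-ω) := fun v =>
  (hω v).neg.congr fun x _ => by simp

/-- Differences. [cite: BochnakCosteRoy1998, Prop. 2.2.6] -/
theorem sub (hω : IsSemialgebraicFormOn S ω) (hω' : IsSemialgebraicFormOn S ω') :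
    IsSemialgebraicFormOn S (ω - ω') := fun v =>
  (IsSemialgebraicFunOn.sub_holds (hω v) (hω' v)).congr fun x _ => by simp

/-- Products with a semialgebraic function. [cite: BochnakCosteRoy1998, Prop. 2.2.6] -/
theorem smul {f : (Fin N → ℝ) → ℝ} (hf : IsSemialgebraicFunOn ℚ S f) (hω : IsSemialgebraicFormOn S ω) :
    IsSemialgebraicFormOn S (fun x => f x • ω x) := fun v =>
  (IsSemialgebraicFunOn.mul_holds hf (hω v)).congr fun x _ => by simp

end IsSemialgebraicFormOn

/-- The zero form has semialgebraic coefficients on every semialgebraic set. [folklore] -/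
theorem isSemialgebraicFormOn_zero {S : Set (Fin N → ℝ)} (hS : IsSemialgebraic ℚ S) :
    IsSemialgebraicFormOn S (0 : (Fin N → ℝ) → (Fin N → ℝ) [⋀^Fin d]→L[ℝ] ℝ) := fun _ => by
  simpa using isSemialgebraicFunOn_natCast hS 0

/-- The **pull-back density** of a `d`-form `ω` on `ℝᴺ` along a cell `c : [0,1]ᵈ → ℝᴺ`: the
coefficient `f` of the top form `c^*ω = f dt₁ ∧ ⋯ ∧ dt_d` on the parameter cube,
`f t = (c^*ω)_t (e₁, …, e_d) = ω (c t) (∂₁c (t), …, ∂_d c (t))` with `∂ᵢc (t) = fderiv ℝ c t eᵢ`, so that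
`∫_c ω = ∫_{[0,1]ᵈ} f` (Spivak). Values off the closed cube are junk.
[cite: Spivak1965, Ch. 4 (the integral of a form over a singular cube)] -/
def pullbackDensity (c : NashCubeMap d N) (ω : (Fin N → ℝ) → (Fin N → ℝ) [⋀^Fin d]→L[ℝ] ℝ) :
    (Fin d → ℝ) → ℝ :=
  fun t => ω (c t) fun i => fderiv ℝ c t (Pi.single i 1)

/-- Unfolding lemma for the pull-back density. [cite: Spivak1965, Ch. 4] -/
theorem pullbackDensity_apply (c : NashCubeMap d N) (ω : (Fin N → ℝ) → (Fin N → ℝ) [⋀^Fin d]→L[ℝ] ℝ)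
    (t : Fin d → ℝ) : pullbackDensity c ω t = ω (c t) fun i => fderiv ℝ c t (Pi.single i 1) := rfl

/-- The pull-back density is Mathlib's pull-back `(ω (c t)).compContinuousLinearMap (fderiv ℝ c t)`
evaluated on the standard basis. [cite: Spivak1965, Ch. 4] -/
theorem pullbackDensity_eq_compContinuousLinearMap (c : NashCubeMap d N)
    (ω : (Fin N → ℝ) → (Fin N → ℝ) [⋀^Fin d]→L[ℝ] ℝ) (t : Fin d → ℝ) :
    pullbackDensity c ω t =
      (ω (c t)).compContinuousLinearMap (fderiv ℝ c t) (fun i => Pi.single i 1) := rfl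

/-- **Coordinate expansion** of the pull-back density (multilinearity):
`f t = Σ_{v : Fin d → Fin N} (Π_i ∂ᵢ c_{v i} (t)) · ω (c t) (e_{v 0}, …, e_{v (d-1)})`.
[cite: Spivak1965, Ch. 4] -/
theorem pullbackDensity_eq_sum (c : NashCubeMap d N) (ω : (Fin N → ℝ) → (Fin N → ℝ) [⋀^Fin d]→L[ℝ] ℝ)
    (t : Fin d → ℝ) :
    pullbackDensity c ω t = ∑ v : Fin d → Fin N,
      (∏ i, fderiv ℝ c t (Pi.single i 1) (v i)) * ω (c t) (fun i => Pi.single (v i) 1) := by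
  rw [pullbackDensity_apply]
  have h : (fun i => fderiv ℝ c t (Pi.single i 1)) =
      fun i => ∑ j : Fin N, fderiv ℝ c t (Pi.single i 1) j • (Pi.single j (1 : ℝ) : Fin N → ℝ) :=
    funext fun i => eq_sum_smul_single _
  rw [h, ContinuousAlternatingMap.map_sum]
  refine Finset.sum_congr rfl fun v _ => ?_
  rw [ContinuousAlternatingMap.map_smul_univ, smul_eq_mul]

/-- **Semialgebraicity of the pull-back density.** If `ω` has `ℚ`-semialgebraic coefficients on `S`
and the cell `c` maps the closed cube into `S`, then `pullbackDensity c ω` is a `ℚ`-semialgebraic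
function on the closed cube: by the coordinate expansion it is a polynomial in the partial
derivatives `∂ᵢcⱼ` (semialgebraic on the closed cube, `NashCubeMap.isSemialgebraicFunOn_fderiv`) and the
composites `(x ↦ ω x e_v) ∘ c` (Bochnak–Coste–Roy Prop. 2.2.6). [cite: BochnakCosteRoy1998, Prop. 2.2.6] -/
theorem IsSemialgebraicFormOn.isSemialgebraicFunOn_pullbackDensity {S : Set (Fin N → ℝ)}
    {ω : (Fin N → ℝ) → (Fin N → ℝ) [⋀^Fin d]→L[ℝ] ℝ} (hω : IsSemialgebraicFormOn S ω)
    (c : NashCubeMap d N) (hc : MapsTo c (closedUnitCube d) S) :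
    IsSemialgebraicFunOn ℚ (closedUnitCube d) (pullbackDensity c ω) := by
  have h : pullbackDensity c ω = fun t => ∑ v : Fin d → Fin N,
      (∏ i, fderiv ℝ c t (Pi.single i 1) (v i)) * ω (c t) (fun i => Pi.single (v i) 1) :=
    funext (pullbackDensity_eq_sum c ω)
  rw [h]
  refine isSemialgebraicFunOn_finsetSum _ isSemialgebraic_closedUnitCube fun v _ => ?_
  have hprod : IsSemialgebraicFunOn ℚ (closedUnitCube d)
      fun t => ∏ i, fderiv ℝ c t (Pi.single i 1) (v i) :=
    isSemialgebraicFunOn_finsetProd _ isSemialgebraic_closedUnitCube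
      fun i _ => c.isSemialgebraicFunOn_fderiv i (v i)
  have hcomp : IsSemialgebraicFunOn ℚ (closedUnitCube d)
      ((fun x => ω x fun i => Pi.single (v i) 1) ∘ c) :=
    IsSemialgebraicFunOn.comp_isSemialgebraicMapOn_holds (hω v) c.isSemialgebraicMapOn hc
  exact (IsSemialgebraicFunOn.mul_holds hprod hcomp).congr fun t _ => rfl

/-- **Continuity of the pull-back density**: if the coefficients of `ω` are continuous on `S` and `c`
maps the closed cube into `S`, the density is continuous on the closed cube (`c` is `C¹` on a
neighbourhood of the closed cube). [cite: Spivak1965, Ch. 4] -/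
theorem continuousOn_pullbackDensity {S : Set (Fin N → ℝ)}
    {ω : (Fin N → ℝ) → (Fin N → ℝ) [⋀^Fin d]→L[ℝ] ℝ}
    (hω : ∀ v : Fin d → Fin N, ContinuousOn (fun x => ω x fun i => Pi.single (v i) 1) S)
    (c : NashCubeMap d N) (hc : MapsTo c (closedUnitCube d) S) :
    ContinuousOn (pullbackDensity c ω) (closedUnitCube d) := by
  have h : pullbackDensity c ω = fun t => ∑ v : Fin d → Fin N,
      (∏ i, fderiv ℝ c t (Pi.single i 1) (v i)) * ω (c t) (fun i => Pi.single (v i) 1) :=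
    funext (pullbackDensity_eq_sum c ω)
  rw [h]
  obtain ⟨U, hU, hsub, hcU⟩ := c.exists_contDiffOn
  have hD : ContinuousOn (fderiv ℝ c) U := hcU.continuousOn_fderiv_of_isOpen hU le_rfl
  refine continuousOn_finsetSum _ fun v _ => ContinuousOn.mul ?_ ?_
  · refine continuousOn_finsetProd _ fun i _ => ?_
    have h1 : ContinuousOn (fun t => fderiv ℝ c t (Pi.single i 1)) (closedUnitCube d) :=
      ((continuous_eval_const (Pi.single i (1 : ℝ) : Fin d → ℝ)).comp_continuousOn hD).mono hsub
    exact (continuous_apply (v i)).comp_continuousOn h1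
  · exact (hω v).comp c.continuousOn hc

/-- The density of the `(j, ε)`-face of a cell, on the closed cube, in terms of the big cell: with
`y = insertNth j ε t`, `pullbackDensity (c.face j ε) ω t = ω (c y) (∂_{j.succAbove 0} c (y), …)` — the
coefficient `Aⱼ` of `dt̂ⱼ` in `c^*ω`, restricted to the face `{tⱼ = ε}` (chain rule through the affine
face embedding). This identifies the face representations of `KZ.chainRep (∂ c) ω` with the data
`ρ_ε j` of item `ZeroBulkStokes`. [cite: Spivak1965, Ch. 4, proof of Thm. 4-13] -/
theorem pullbackDensity_face (c : NashCubeMap (d + 1) N) (j : Fin (d + 1)) (ε : Fin 2)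
    (ω : (Fin N → ℝ) → (Fin N → ℝ) [⋀^Fin d]→L[ℝ] ℝ) {t : Fin d → ℝ} (ht : t ∈ closedUnitCube d) :
    pullbackDensity (c.face j ε) ω t =
      ω (c (NashCubeMap.faceMap j ε t))
        fun i => fderiv ℝ c (NashCubeMap.faceMap j ε t) (Pi.single (j.succAbove i) 1) := by
  rw [pullbackDensity_apply, NashCubeMap.coe_face]
  have hcx : DifferentiableAt ℝ c (NashCubeMap.faceMap j ε t) :=
    c.differentiableAt (NashCubeMap.mapsTo_faceMap j ε ht)
  simp only [Function.comp_apply]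
  congr 1
  funext i
  rw [fderiv_comp t hcx (NashCubeMap.hasFDerivAt_faceMap j ε t).differentiableAt,
    (NashCubeMap.hasFDerivAt_faceMap j ε t).fderiv, ContinuousLinearMap.comp_apply,
    NashCubeMap.faceMapLinear_single]

/-! ## Coordinate forms `dx_I` -/

/-- The **basic coordinate `d`-form** `dx_I = dx_{I 0} ∧ ⋯ ∧ dx_{I (d-1)}` on `ℝᴺ` for a multi-index
`I : Fin d → Fin N`, as a (constant) continuous alternating map: on `d` vectors `v₀, …, v_{d-1}` it is
the `I`-minor `det (v_j (I i))_{j,i}` (Spivak, Thm. 4-6: an alternating `d`-tensor evaluates through the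
determinant of the coordinate matrix). Built from Mathlib's `Matrix.detRowAlternating` composed with
the coordinate projection `w ↦ w ∘ I`. [cite: Spivak1965, Thm. 4-6] -/
def basicForm (I : Fin d → Fin N) : (Fin N → ℝ) [⋀^Fin d]→L[ℝ] ℝ :=
  { (Matrix.detRowAlternating : (Fin d → ℝ) [⋀^Fin d]→ₗ[ℝ] ℝ).compLinearMap
      (LinearMap.funLeft ℝ ℝ I) with
    cont := by
      change Continuous fun v : Fin d → Fin N → ℝ =>
        Matrix.det (Matrix.of fun j i => v j (I i) : Matrix (Fin d) (Fin d) ℝ)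
      exact Continuous.matrix_det
        (continuous_pi fun j => continuous_pi fun i => (continuous_apply (I i)).comp (continuous_apply j)) }

/-- `dx_I (v₀, …, v_{d-1}) = det (v_j (I i))_{j,i}`. [cite: Spivak1965, Thm. 4-6] -/
@[simp]
theorem basicForm_apply (I : Fin d → Fin N) (v : Fin d → Fin N → ℝ) :
    basicForm I v = Matrix.det (Matrix.of fun j i => v j (I i)) := rfl

/-- On standard basis vectors `dx_I (e_{v 0}, …, e_{v (d-1)})` is the integer `det (δ_{I i, v j})`.
[cite: Spivak1965, Thm. 4-6] -/
theorem basicForm_apply_single (I v : Fin d → Fin N) :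
    basicForm I (fun j => Pi.single (v j) (1 : ℝ)) =
      ((Matrix.of fun j i => if I i = v j then (1 : ℤ) else 0).det : ℝ) := by
  rw [basicForm_apply, Int.cast_det]
  congr 1
  ext j i
  simp [Matrix.map_apply, Pi.single_apply]

/-- The constant form `dx_I` has `ℚ`-semialgebraic (indeed integer constant) coefficients on every
`ℚ`-semialgebraic set. [cite: BochnakCosteRoy1998, §2.2] -/
theorem isSemialgebraicFormOn_basicForm {S : Set (Fin N → ℝ)} (hS : IsSemialgebraic ℚ S)
    (I : Fin d → Fin N) : IsSemialgebraicFormOn S fun _ => basicForm I := fun v => by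
  simpa only [basicForm_apply_single] using isSemialgebraicFunOn_intCast hS _

/-- The coordinate coefficients of a form written in coordinates, `ω = Σ_{I ∈ s} a_I dx_{e I}`:
`ω x (e_{v 0}, …) = Σ_{I ∈ s} a_I x · det (δ_{e I i, v j})`. [cite: Spivak1965, Thm. 4-6] -/
theorem sum_smul_basicForm_apply_single {ι : Type*} (s : Finset ι) (e : ι → Fin d → Fin N)
    (a : ι → (Fin N → ℝ) → ℝ) (x : Fin N → ℝ) (v : Fin d → Fin N) :
    (∑ I ∈ s, a I x • basicForm (e I)) (fun j => Pi.single (v j) 1) =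
      ∑ I ∈ s, a I x * ((Matrix.of fun j i => if e I i = v j then (1 : ℤ) else 0).det : ℝ) := by
  rw [ContinuousAlternatingMap.sum_apply]
  refine Finset.sum_congr rfl fun I _ => ?_
  rw [ContinuousAlternatingMap.smul_apply, basicForm_apply_single, smul_eq_mul]

/-- **Forms in coordinates have semialgebraic coefficients**: `ω = Σ_{I ∈ s} a_I dx_{e I}` with
`ℚ`-semialgebraic coefficient functions `a_I` on `S` satisfies `IsSemialgebraicFormOn S ω` (each
coordinate coefficient is `Σ a_I ·` an integer). [cite: BochnakCosteRoy1998, Prop. 2.2.6] -/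
theorem isSemialgebraicFormOn_sum_smul_basicForm {ι : Type*} (s : Finset ι) (e : ι → Fin d → Fin N)
    {S : Set (Fin N → ℝ)} (hS : IsSemialgebraic ℚ S) {a : ι → (Fin N → ℝ) → ℝ}
    (ha : ∀ I ∈ s, IsSemialgebraicFunOn ℚ S (a I)) :
    IsSemialgebraicFormOn S fun x => ∑ I ∈ s, a I x • basicForm (e I) := by
  intro v
  simp only [sum_smul_basicForm_apply_single]
  exact isSemialgebraicFunOn_finsetSum s hS fun I hI =>
    (IsSemialgebraicFunOn.mul_holds (ha I hI) (isSemialgebraicFunOn_intCast hS _)).congr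
      fun x _ => rfl

/-- The coordinate coefficients of a form in coordinates are continuous where its coefficient
functions are. [folklore] -/
theorem continuousOn_sum_smul_basicForm_apply_single {ι : Type*} (s : Finset ι)
    (e : ι → Fin d → Fin N) {S : Set (Fin N → ℝ)} {a : ι → (Fin N → ℝ) → ℝ}
    (ha : ∀ I ∈ s, ContinuousOn (a I) S) (v : Fin d → Fin N) :
    ContinuousOn (fun x => (∑ I ∈ s, a I x • basicForm (e I)) fun j => Pi.single (v j) 1) S := by
  simp only [sum_smul_basicForm_apply_single]
  exact continuousOn_finsetSum s fun I hI => (ha I hI).mul continuousOn_const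

/-- **The pull-back density in coordinates** (Jacobian minors; Spivak, Thm. 4-9 in top degree):
for `ω = Σ_{I ∈ s} a_I dx_{e I}`,
`pullbackDensity c ω t = Σ_{I ∈ s} a_I (c t) · det (∂_j c_{e I i} (t))_{j,i}`.
[cite: Spivak1965, Thm. 4-9] -/
theorem pullbackDensity_sum_smul_basicForm {ι : Type*} (s : Finset ι) (e : ι → Fin d → Fin N)
    (a : ι → (Fin N → ℝ) → ℝ) (c : NashCubeMap d N) (t : Fin d → ℝ) :
    pullbackDensity c (fun x => ∑ I ∈ s, a I x • basicForm (e I)) t =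
      ∑ I ∈ s, a I (c t) * Matrix.det (Matrix.of fun j i => fderiv ℝ c t (Pi.single j 1) (e I i)) := by
  rw [pullbackDensity_apply, ContinuousAlternatingMap.sum_apply]
  refine Finset.sum_congr rfl fun I _ => ?_
  rw [ContinuousAlternatingMap.smul_apply, basicForm_apply, smul_eq_mul]

/-! ## The KZ representation of a form along a chain -/

namespace KZ

/-- The side condition under which the cell representation `[closed unit cube, pullbackDensity c ω]`
is an integral representation of the KZ calculus: the density is a `ℚ`-semialgebraic function on the
closed cube (automatic for forms with semialgebraic coefficients along the cell,
`IsSemialgebraicFormOn.isSemialgebraicFunOn_pullbackDensity`) and absolutely integrable there (the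
request's "defined when the pulled-back coefficient is integrable"). [cite: KontsevichZagier2001, §1.1] -/
def CubeRepDefined (c : NashCubeMap d N) (ω : (Fin N → ℝ) → (Fin N → ℝ) [⋀^Fin d]→L[ℝ] ℝ) : Prop :=
  IsSemialgebraicFunOn ℚ (closedUnitCube d) (pullbackDensity c ω) ∧
    IntegrableOn (pullbackDensity c ω) (closedUnitCube d)

open Classical in
/-- The **cell representation** `[closed unit d-cube, pullbackDensity c ω] : KZ.IntegralRep d` of a
`d`-form along a `d`-cell, `∫_c ω = ∫_{[0,1]ᵈ} c^*ω` read as an integral representation of the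
Kontsevich–Zagier calculus; if the side condition `CubeRepDefined c ω` fails, the junk value
`[closed unit d-cube, 0]`. [cite: Spivak1965, Ch. 4 (the integral over a singular cube)] -/
def cubeRep (c : NashCubeMap d N) (ω : (Fin N → ℝ) → (Fin N → ℝ) [⋀^Fin d]→L[ℝ] ℝ) : IntegralRep d :=
  if h : CubeRepDefined c ω then
    { domain := closedUnitCube d
      integrand := pullbackDensity c ω
      isSemialgebraic_domain := isSemialgebraic_closedUnitCube
      isSemialgebraicFunOn_integrand := h.1
      integrableOn := h.2 }
  else
    { domain := closedUnitCube d
      integrand := 0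
      isSemialgebraic_domain := isSemialgebraic_closedUnitCube
      isSemialgebraicFunOn_integrand :=
        (isSemialgebraicFunOn_natCast (isSemialgebraic_closedUnitCube (d := d)) 0).congr
          fun x _ => by simp
      integrableOn := integrableOn_zero }

section Cell

variable {c : NashCubeMap d N} {ω : (Fin N → ℝ) → (Fin N → ℝ) [⋀^Fin d]→L[ℝ] ℝ}

variable (c ω) in
/-- The domain of a cell representation is the closed unit cube. [folklore] -/
@[simp]
theorem cubeRep_domain : (cubeRep c ω).domain = closedUnitCube d := by
  unfold cubeRep
  split_ifs <;> rfl

/-- Under the side condition, the integrand of the cell representation is the pull-back density.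
[cite: Spivak1965, Ch. 4] -/
theorem cubeRep_integrand (h : CubeRepDefined c ω) : (cubeRep c ω).integrand = pullbackDensity c ω := by
  unfold cubeRep
  rw [dif_pos h]

/-- Off the side condition, the integrand of the cell representation is `0` (junk value). [folklore] -/
theorem cubeRep_integrand_of_not (h : ¬CubeRepDefined c ω) : (cubeRep c ω).integrand = 0 := by
  unfold cubeRep
  rw [dif_neg h]

/-- Under the side condition, the cell representation represents `∫_{[0,1]ᵈ} c^*ω`.
[cite: Spivak1965, Ch. 4] -/
theorem value_cubeRep (h : CubeRepDefined c ω) :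
    (cubeRep c ω).value = ∫ t in closedUnitCube d, pullbackDensity c ω t := by
  rw [IntegralRep.value, cubeRep_domain, cubeRep_integrand h]

/-- Off the side condition, the cell representation represents `0`. [folklore] -/
theorem value_cubeRep_of_not (h : ¬CubeRepDefined c ω) : (cubeRep c ω).value = 0 := by
  rw [IntegralRep.value, cubeRep_integrand_of_not h]
  simp

/-- **Sufficient condition**: a form with `ℚ`-semialgebraic coefficients which are continuous on a
set `S` containing the image of the closed cube has a well-defined cell representation (the density is
semialgebraic, and continuous on the compact cube hence integrable). [cite: KontsevichZagier2001, §1.1] -/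
theorem cubeRepDefined_of_continuousOn {S : Set (Fin N → ℝ)} (hω : IsSemialgebraicFormOn S ω)
    (hcont : ∀ v : Fin d → Fin N, ContinuousOn (fun x => ω x fun i => Pi.single (v i) 1) S)
    (hc : MapsTo c (closedUnitCube d) S) : CubeRepDefined c ω :=
  ⟨hω.isSemialgebraicFunOn_pullbackDensity c hc,
    (continuousOn_pullbackDensity hcont c hc).integrableOn_compact isCompact_closedUnitCube⟩

/-- **Forms in coordinates along a cell**: `ω = Σ_{I ∈ s} a_I dx_{e I}` with coefficient functions
`a_I` that are `ℚ`-semialgebraic and continuous on a set `S` containing the image of the closed cube has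
a well-defined cell representation `[closed unit cube, Σ_I (a_I ∘ c) · det (∂_j c_{e I i})]`.
[cite: KontsevichZagier2001, §1.1] -/
theorem cubeRepDefined_sum_smul_basicForm {ι : Type*} (s : Finset ι) (e : ι → Fin d → Fin N)
    {S : Set (Fin N → ℝ)} (hS : IsSemialgebraic ℚ S) {a : ι → (Fin N → ℝ) → ℝ}
    (ha : ∀ I ∈ s, IsSemialgebraicFunOn ℚ S (a I)) (ha' : ∀ I ∈ s, ContinuousOn (a I) S)
    (hc : MapsTo c (closedUnitCube d) S) :
    CubeRepDefined c fun x => ∑ I ∈ s, a I x • basicForm (e I) :=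
  cubeRepDefined_of_continuousOn (isSemialgebraicFormOn_sum_smul_basicForm s e hS ha)
    (continuousOn_sum_smul_basicForm_apply_single s e ha') hc

end Cell

/-- **The KZ representation of a `d`-form along a cubical `d`-chain**, as an additive map:
`Σⱼ nⱼ cⱼ ↦ Σⱼ nⱼ [closed unit d-cube, pullbackDensity cⱼ ω]` (Spivak: `∫_{Σ aᵢcᵢ} ω = Σ aᵢ ∫_{cᵢ} ω`).
[cite: Spivak1965, Ch. 4 (the integral over a chain)] -/
def chainRepHom (ω : (Fin N → ℝ) → (Fin N → ℝ) [⋀^Fin d]→L[ℝ] ℝ) :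
    SemialgebraicCubicalChain d N →+ FormalRep :=
  FreeAbelianGroup.lift fun c => of (cubeRep c ω)

/-- **The KZ representation of a `d`-form along a cubical `d`-chain** `Γ = Σⱼ nⱼ cⱼ`:
`KZ.chainRep Γ ω = Σⱼ nⱼ [closed unit d-cube, pullbackDensity cⱼ ω] : KZ.FormalRep`, the formal
`ℤ`-combination of integral representations on which Kontsevich–Zagier's rules act
(rule (3), "Stokes's formula", relates `chainRep (∂ Γ) η` to `chainRep Γ (dη)`).
[cite: KontsevichZagier2001, §1.2, rule (3)] -/
def chainRep (Γ : SemialgebraicCubicalChain d N) (ω : (Fin N → ℝ) → (Fin N → ℝ) [⋀^Fin d]→L[ℝ] ℝ) :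
    FormalRep :=
  chainRepHom ω Γ

section Chain

variable (ω : (Fin N → ℝ) → (Fin N → ℝ) [⋀^Fin d]→L[ℝ] ℝ)

/-- `chainRepHom ω Γ = chainRep Γ ω`. [folklore] -/
@[simp]
theorem chainRepHom_apply (Γ : SemialgebraicCubicalChain d N) : chainRepHom ω Γ = chainRep Γ ω := rfl

/-- The representation along a single cell. [cite: Spivak1965, Ch. 4] -/
@[simp]
theorem chainRep_of (c : NashCubeMap d N) : chainRep (FreeAbelianGroup.of c) ω = of (cubeRep c ω) :=
  FreeAbelianGroup.lift_apply_of _ _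

/-- The representation along the zero chain. [folklore] -/
@[simp]
theorem chainRep_zero : chainRep (0 : SemialgebraicCubicalChain d N) ω = 0 :=
  map_zero (chainRepHom ω)

/-- Additivity in the chain. [cite: Spivak1965, Ch. 4] -/
@[simp]
theorem chainRep_add (Γ₁ Γ₂ : SemialgebraicCubicalChain d N) :
    chainRep (Γ₁ + Γ₂) ω = chainRep Γ₁ ω + chainRep Γ₂ ω :=
  map_add (chainRepHom ω) Γ₁ Γ₂

/-- Negation in the chain. [folklore] -/
@[simp]
theorem chainRep_neg (Γ : SemialgebraicCubicalChain d N) : chainRep (-Γ) ω = -chainRep Γ ω :=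
  map_neg (chainRepHom ω) Γ

/-- Subtraction in the chain. [folklore] -/
@[simp]
theorem chainRep_sub (Γ₁ Γ₂ : SemialgebraicCubicalChain d N) :
    chainRep (Γ₁ - Γ₂) ω = chainRep Γ₁ ω - chainRep Γ₂ ω :=
  map_sub (chainRepHom ω) Γ₁ Γ₂

/-- Integer multiples in the chain. [folklore] -/
@[simp]
theorem chainRep_zsmul (n : ℤ) (Γ : SemialgebraicCubicalChain d N) :
    chainRep (n • Γ) ω = n • chainRep Γ ω :=
  map_zsmul (chainRepHom ω) n Γ

/-- Finite sums in the chain. [folklore] -/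
theorem chainRep_sum {ι : Type*} (s : Finset ι) (Γ : ι → SemialgebraicCubicalChain d N) :
    chainRep (∑ i ∈ s, Γ i) ω = ∑ i ∈ s, chainRep (Γ i) ω :=
  map_sum (chainRepHom ω) Γ s

variable {ω} in
/-- The value of the representation along a single cell is `∫_{[0,1]ᵈ} c^*ω` (under the side
condition). [cite: Spivak1965, Ch. 4] -/
theorem eval_chainRep_of {c : NashCubeMap d N} (h : CubeRepDefined c ω) :
    eval (chainRep (FreeAbelianGroup.of c) ω) = ∫ t in closedUnitCube d, pullbackDensity c ω t := by
  rw [chainRep_of, eval_of, value_cubeRep h]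

/-- **The boundary representation of a cell** is the signed face sum
`chainRep (∂ c) ω = Σⱼ (−1)ʲ ([cubeRep (c.face j 1) ω] − [cubeRep (c.face j 0) ω])` — literally the
element `Σ_k (−1)^k ([ρ₁ k] − [ρ₀ k])` of item `ZeroBulkStokes` with `ρ_ε k = cubeRep (c.face k ε) ω`.
[cite: KontsevichZagier2001, §1.2, rule (3)] -/
theorem chainRep_boundary_of (c : NashCubeMap (d + 1) N) :
    chainRep (SemialgebraicCubicalChain.boundary (FreeAbelianGroup.of c)) ω =
      ∑ j : Fin (d + 1), (-1 : ℤ) ^ (j : ℕ) •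
        (of (cubeRep (c.face j 1) ω) - of (cubeRep (c.face j 0) ω)) := by
  rw [SemialgebraicCubicalChain.boundary_of, chainRep_sum]
  refine Finset.sum_congr rfl fun j _ => ?_
  rw [chainRep_zsmul, chainRep_sub, chainRep_of, chainRep_of]

/-- The side condition for a whole chain: every cell in the support of `Γ` has a well-defined cell
representation. [cite: KontsevichZagier2001, §1.1] -/
def ChainRepDefined (Γ : SemialgebraicCubicalChain d N) : Prop :=
  ∀ c ∈ Γ.support, CubeRepDefined c ω

/-- The side condition for a single cell. [folklore] -/
theorem chainRepDefined_of_iff (c : NashCubeMap d N) :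
    ChainRepDefined ω (FreeAbelianGroup.of c) ↔ CubeRepDefined c ω := by
  simp [ChainRepDefined, FreeAbelianGroup.support_of]

variable {ω} in
/-- A form with `ℚ`-semialgebraic coefficients continuous on `S` has a well-defined representation
along every chain all of whose cells map the closed cube into `S`. [cite: KontsevichZagier2001, §1.1] -/
theorem chainRepDefined_of_continuousOn {S : Set (Fin N → ℝ)} (hω : IsSemialgebraicFormOn S ω)
    (hcont : ∀ v : Fin d → Fin N, ContinuousOn (fun x => ω x fun i => Pi.single (v i) 1) S)
    {Γ : SemialgebraicCubicalChain d N} (hΓ : ∀ c ∈ Γ.support, MapsTo c (closedUnitCube d) S) :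
    ChainRepDefined ω Γ :=
  fun c hc => cubeRepDefined_of_continuousOn hω hcont (hΓ c hc)

/-- The representation along a chain, cell by cell over the support:
`chainRep Γ ω = Σ_{c ∈ supp Γ} (coeff_c Γ) • [cubeRep c ω]`. [cite: Spivak1965, Ch. 4] -/
theorem chainRep_eq_sum_support (Γ : SemialgebraicCubicalChain d N) :
    chainRep Γ ω = ∑ c ∈ Γ.support, FreeAbelianGroup.coeff c Γ • of (cubeRep c ω) := by
  conv_lhs => rw [← SemialgebraicCubicalChain.sum_coeff_smul_of Γ]
  rw [chainRep_sum]
  simp only [chainRep_zsmul, chainRep_of]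

variable {ω} in
/-- **The value of the representation along a chain** `Γ = Σⱼ nⱼ cⱼ` is `Σⱼ nⱼ ∫_{[0,1]ᵈ} cⱼ^*ω`
(under the side condition on every cell of the support; Spivak's `∫_{Σ aᵢcᵢ} ω = Σ aᵢ ∫_{cᵢ} ω`).
[cite: Spivak1965, Ch. 4 (the integral over a chain)] -/
theorem eval_chainRep {Γ : SemialgebraicCubicalChain d N} (h : ChainRepDefined ω Γ) :
    eval (chainRep Γ ω) = ∑ c ∈ Γ.support,
      (FreeAbelianGroup.coeff c Γ : ℝ) * ∫ t in closedUnitCube d, pullbackDensity c ω t := by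
  rw [chainRep_eq_sum_support, map_sum]
  refine Finset.sum_congr rfl fun c hc => ?_
  rw [map_zsmul, eval_of, value_cubeRep (h c hc), zsmul_eq_mul]

end Chain

end KZ

end Literature.NumberTheory.Transcendental
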